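import Summits.AtomisticToContinuum.FouriersLaw.Theses.OddSectorIrreversibility

/-!
# Sketch (crux-ideate, ideator 2, round 1) — first lemmas for two crux ideas on
`OddSectorIrreversibility.ConeScaleCorrector` (E1, item stmt-AtomisticToContinuum-14069)

Defs only (Props), no proofs, no sorry. Notation as in the route: `μT = e^{−H_N/T}·vol` (unnormalised, mass `Z`),
`P_t = transitionKernel N T T t` (equilibrium OPEN kernels), `J = J_tot`, `Θ(q,p) = (q,−p)`.

* Card A `spatial-doob-determinacy-area`: `SpatialDoobIdentity` (first lemma, fixed N), `IncrementLaw` (load-bearing,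
  N-uniform), `AreaLaw` (transfer form).
* Card B `contact-heat-reversal-asymmetry`: `OddCorrectorIsContactHeat` (first lemma, fixed N), `ParityTransfer`
  (fixed N), `ContactReversalBound` (load-bearing (O)), `FirstMomentFloor` ((M), one-sided Green–Kubo first moment).
-/

noncomputable section

open MeasureTheory Filter Topology Set
open scoped ENNReal NNReal
open Literature.MathematicalPhysics.KineticTheory.HeatConduction

namespace Summit.AtomisticToContinuum.FouriersLaw.Cruxes.ConeScaleCorrector.SketchIdeator2

/-- unnormalised Gibbs weight `e^{−H_N/T} dq dp` of the chain `P` (as in the crux). -/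
def gibbsW (P : OscillatorChain) (N : ℕ) (T : ℝ) : Measure (PhaseSpace N) :=
  volume.withDensity (fun x : PhaseSpace N => ENNReal.ofReal (Real.exp (-(P.hamiltonian N x) / T)))

/-- its mass `Z`. -/
def Zmass (P : OscillatorChain) (N : ℕ) (T : ℝ) : ℝ :=
  ∫ x, Real.exp (-(P.hamiltonian N x) / T) ∂(volume : Measure (PhaseSpace N))

/-- total current `J_tot = Σ_i j_i`. -/
def Jtot (P : OscillatorChain) (N : ℕ) : PhaseSpace N → ℝ := fun z => ∑ i : Fin N, P.bondCurrent N i z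

/-- `(P_t g)(x)` for the equilibrium open kernels at temperature `T`. -/
def evolve (P : OscillatorChain) (N : ℕ) (T t : ℝ) (g : PhaseSpace N → ℝ) (x : PhaseSpace N) : ℝ :=
  ∫ y, g y ∂(P.transitionKernel N T T t.toNNReal x)

/-- `u` is an a.e.-limit of the finite-horizon correctors `∫₀^τ P_t g dt` of the observable `g`
(verbatim the hypothesis shape of the crux, with `g = J_tot`). -/
def IsCorrectorOf (P : OscillatorChain) (N : ℕ) (T : ℝ) (g u : PhaseSpace N → ℝ) : Prop :=
  ∀ᵐ x ∂(gibbsW P N T), Tendsto (fun τ : ℝ => ∫ t in Set.Ioc (0 : ℝ) τ, evolve P N T t g x) atTop (𝓝 (u x))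

/-- momentum reversal `Θ`. -/
def flipP {N : ℕ} (x : PhaseSpace N) : PhaseSpace N := (x.1, -x.2)

/-- equilibrium total-current autocorrelation `C_N(t) = ∫ J · P_tJ dμ_T` (unnormalised). -/
def autocorr (P : OscillatorChain) (N : ℕ) (T t : ℝ) : ℝ :=
  ∫ z, Jtot P N z * evolve P N T t (Jtot P N) z ∂(gibbsW P N T)

/-- the σ-algebra generated by the first `k` sites `(q_i, p_i)_{i<k}` (`k = 0`: trivial; `k = N`: everything). -/
@[reducible] def leftAlg (N k : ℕ) : MeasurableSpace (PhaseSpace N) :=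
  ⨆ (i : Fin N) (_ : i.val < k), MeasurableSpace.comap (fun x : PhaseSpace N => (x.1 i, x.2 i)) inferInstance

/-! ## Card A — spatial Doob martingale / determinacy area law -/

/-- FIRST LEMMA (card A, fixed `N`, pure measure theory): the Doob martingale of a mean-zero `u ∈ L²(μ_T)` along the
chain has orthogonal increments, so `∫ u² dμ_T = Σ_{k<N} ∫ (E[u | sites < k+1] − E[u | sites < k])² dμ_T`
(conditional expectations under the finite measure `μ_T`; `leftAlg N N` is the full Borel σ-algebra, `leftAlg N 0 = ⊥`). -/
def SpatialDoobIdentity : Prop :=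
  ∀ ω₂ lam β γ : ℝ, 0 < ω₂ → 0 < lam → 0 < β → 0 < γ → ∀ T : ℝ, 0 < T → ∀ (N : ℕ) (u : PhaseSpace N → ℝ),
    let P := pinnedChain ω₂ lam β γ
    MemLp u 2 (gibbsW P N T) → ∫ x, u x ∂(gibbsW P N T) = 0 →
      ∫ x, (u x) ^ 2 ∂(gibbsW P N T) =
        ∑ k : Fin N, ∫ x, ((gibbsW P N T)[u|leftAlg N (k.val + 1)] x - (gibbsW P N T)[u|leftAlg N k.val] x) ^ 2
          ∂(gibbsW P N T)

/-- LOAD-BEARING STUB (card A, `N`-uniform): the DETERMINACY INCREMENT LAW — revealing the initial microstate of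
site `k`, given the sites to its left, changes the forecast of the total future transport by at most `O(√(1+k))` in
`L²(μ_T)`: `‖E[u | sites ≤ k] − E[u | sites < k]‖² ≤ C (1+k) Z`. Summed with `SpatialDoobIdentity` it gives
`∫ u² ≤ C N(N+1)/2 · Z`, i.e. `ConeScaleCorrector`. Heuristic value `C ≈ Var(e)·D/(2 v_B)`; harmonic member:
increments `≍ k·N` (fails as it must). -/
def IncrementLaw : Prop :=
  ∀ ω₂ lam β γ : ℝ, 0 < ω₂ → 0 < lam → 0 < β → 0 < γ → ∀ T : ℝ, 0 < T → ∃ C : ℝ,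
    ∀ (N : ℕ) (u : PhaseSpace N → ℝ),
    let P := pinnedChain ω₂ lam β γ
    IsCorrectorOf P N T (Jtot P N) u → ∀ k : Fin N,
      ∫ x, ((gibbsW P N T)[u|leftAlg N (k.val + 1)] x - (gibbsW P N T)[u|leftAlg N k.val] x) ^ 2 ∂(gibbsW P N T)
        ≤ C * ((k.val : ℝ) + 1) * Zmass P N T

/-- TRANSFER FORM (card A): the DETERMINACY AREA LAW `‖E[u | first k sites]‖² ≤ C k² Z` for all `k ≤ N`
(monotone in `k` by the martingale property; `k = N` is `ConeScaleCorrector` itself; its infinite-volume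
analogue — predictable transport content of a `k`-window of Gibbs data under the CLOSED infinite dynamics — is
bath-free and `N`-free). -/
def AreaLaw : Prop :=
  ∀ ω₂ lam β γ : ℝ, 0 < ω₂ → 0 < lam → 0 < β → 0 < γ → ∀ T : ℝ, 0 < T → ∃ C : ℝ,
    ∀ (N : ℕ) (u : PhaseSpace N → ℝ),
    let P := pinnedChain ω₂ lam β γ
    IsCorrectorOf P N T (Jtot P N) u → ∀ k : ℕ, k ≤ N →
      ∫ x, ((gibbsW P N T)[u|leftAlg N k] x) ^ 2 ∂(gibbsW P N T) ≤ C * (k : ℝ) ^ 2 * Zmass P N T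

/-! ## Card B — energy-balance collapse of the odd corrector onto one contact + parity transfer -/

/-- FIRST LEMMA (card B, fixed `N`): every bond corrector has the same `Θ`-odd part, namely that of the contact-heat
corrector `W_L = ∫₀^∞ P_t w_L dt`, `w_L = γ(T − p_0²)` (energy balance `L E_{≤i} = −j_i + w_L`, `E_{≤i}` even);
hence `u − u∘Θ = (N−1)(W_L − W_L∘Θ)` a.e. for the total corrector. -/
def OddCorrectorIsContactHeat : Prop :=
  ∀ ω₂ lam β γ : ℝ, 0 < ω₂ → 0 < lam → 0 < β → 0 < γ → ∀ T : ℝ, 0 < T →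
    ∀ (N : ℕ) (b₀ : Fin N), b₀.val = 0 → ∀ (u W : PhaseSpace N → ℝ),
    let P := pinnedChain ω₂ lam β γ
    IsCorrectorOf P N T (Jtot P N) u →
    IsCorrectorOf P N T (fun x : PhaseSpace N => γ * (T - (x.2 b₀) ^ 2)) W →
      ∀ᵐ x ∂(gibbsW P N T), u x - u (flipP x) = ((N : ℝ) - 1) * (W x - W (flipP x))

/-- PARITY TRANSFER (card B, fixed `N`; uses `Θ`-invariance of `μ_T` and generalised detailed balance
`P_t* = Θ P_t Θ`): `∫ u · (u∘Θ) dμ_T = −∫₀^∞ t C_N(t) dt`, equivalently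
`‖u⁻‖² − ‖u⁺‖² = M₁ := ∫₀^∞ t C_N(t) dt` and `‖u‖² = 2‖u⁻‖² − M₁`. -/
def ParityTransfer : Prop :=
  ∀ ω₂ lam β γ : ℝ, 0 < ω₂ → 0 < lam → 0 < β → 0 < γ → ∀ T : ℝ, 0 < T → ∀ (N : ℕ) (u : PhaseSpace N → ℝ),
    let P := pinnedChain ω₂ lam β γ
    IsCorrectorOf P N T (Jtot P N) u → MemLp u 2 (gibbsW P N T) →
      IntegrableOn (fun t : ℝ => t * autocorr P N T t) (Set.Ioi 0) ∧
      ∫ x, u x * u (flipP x) ∂(gibbsW P N T) = -∫ t in Set.Ioi (0 : ℝ), t * autocorr P N T t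

/-- LOAD-BEARING STUB (O) (card B, `N`-uniform, ONE contact observable): the momentum-reversal asymmetry of the
expected lifetime heat intake from the left bath is `N`-uniformly bounded in `L²(μ_T/Z)`:
`∫ (W_L − W_L∘Θ)² dμ_T ≤ C·Z`. With `OddCorrectorIsContactHeat`: `‖u⁻‖² ≤ C (N−1)²/4 · Z` (E1-odd at its natural
O(1) scale; equivalently the route's corrected namesake `sup_N ‖h − h∘Θ‖_{L²(π)} < ∞`). Heuristic value
`C ≈ Var(e)·D/v_B`; harmonic member `≍ N` (fails as it must). -/
def ContactReversalBound : Prop :=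
  ∀ ω₂ lam β γ : ℝ, 0 < ω₂ → 0 < lam → 0 < β → 0 < γ → ∀ T : ℝ, 0 < T → ∃ C : ℝ,
    ∀ (N : ℕ) (b₀ : Fin N), b₀.val = 0 → ∀ (W : PhaseSpace N → ℝ),
    let P := pinnedChain ω₂ lam β γ
    IsCorrectorOf P N T (fun x : PhaseSpace N => γ * (T - (x.2 b₀) ^ 2)) W →
      MemLp W 2 (gibbsW P N T) ∧
      ∫ x, (W x - W (flipP x)) ^ 2 ∂(gibbsW P N T) ≤ C * Zmass P N T

/-- STUB (M) (card B, `N`-uniform, EVEN sector only): one-sided floor on the first moment of the equilibrium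
total-current autocorrelation of the OPEN chain, `M₁(N) = ∫₀^∞ t C_N(t) dt ≥ −C N² Z` (equivalently
`‖u⁺‖² ≤ ‖u⁻‖² + C N² Z`). With `ParityTransfer`, (O) ∧ (M) ⟺ `ConeScaleCorrector`; the route's witness glue uses
only `‖u⁻‖`, so (M) is needed for E1 AS TYPED but not for the assembly. -/
def FirstMomentFloor : Prop :=
  ∀ ω₂ lam β γ : ℝ, 0 < ω₂ → 0 < lam → 0 < β → 0 < γ → ∀ T : ℝ, 0 < T → ∃ C : ℝ, ∀ N : ℕ,
    let P := pinnedChain ω₂ lam β γ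
    IntegrableOn (fun t : ℝ => t * autocorr P N T t) (Set.Ioi 0) ∧
      -(C * (N : ℝ) ^ 2 * Zmass P N T) ≤ ∫ t in Set.Ioi (0 : ℝ), t * autocorr P N T t

/-- Shape check: the crux's hypothesis is literally `IsCorrectorOf` for `J_tot` (definitional unfolding). -/
example : Summit.AtomisticToContinuum.FouriersLaw.Theses.OddSectorIrreversibility.ConeScaleCorrector ↔
    (∀ ω₂ lam β γ : ℝ, 0 < ω₂ → 0 < lam → 0 < β → 0 < γ → ∀ T : ℝ, 0 < T → ∃ C : ℝ,
      ∀ (N : ℕ) (u : PhaseSpace N → ℝ),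
      IsCorrectorOf (pinnedChain ω₂ lam β γ) N T (Jtot (pinnedChain ω₂ lam β γ) N) u →
        MemLp u 2 (gibbsW (pinnedChain ω₂ lam β γ) N T) ∧
        ∫ x, (u x) ^ 2 ∂(gibbsW (pinnedChain ω₂ lam β γ) N T) ≤
          C * (N : ℝ) ^ 2 * Zmass (pinnedChain ω₂ lam β γ) N T) :=
  Iff.rfl

end Summit.AtomisticToContinuum.FouriersLaw.Cruxes.ConeScaleCorrector.SketchIdeator2
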